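import Summits.AnomalousDissipation.AnomalousDissipation.Theorems.DenseLoudDesignerForces.Negative.ConstantFlux

/-!
# Negative knowledge for the crux `DenseLoudDesignerForces` (stmt-AnomalousDissipation-1143), XIII: the flux
# capacity of the low modes (witness anatomy IV)

Certified copy of §16 of the cdisprove work file (generation 3): `|Π_N(t)| ≤ 6πN√(#B_N)√(E_N(t))‖u(t)‖₂²`
(`abs_flux_le`: the flux is the Reynolds stress working against the strain of the LOW-PASS field,
`‖D(P_N u)‖_∞ ≤ 6πN√(#B_N)√E_N`), the force-free dissipation ceiling
`⟨ν‖∇u‖²⟩ ≤ 6πN√(#B_N) τ⁻¹∫√(E_N)‖u‖₂² + 4π²N²ν⟨‖u‖²⟩` for every periodic classical orbit forced in the band `S ⊆ B_N`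
(`meanDissipation_le_capacity` — the periodic-orbit Doering–Foias bound, in which the amplitude of the force does not
appear), and the loud-set floor `ε - 4π²N²E/(j+1) ≤ 6πN√(#B_N) τ⁻¹∫√(E_N)‖u‖₂²` (`capacity_floor_of_loud`,
`capacity_le_cubic`).  Supports stmt-AnomalousDissipation-1143.
-/

noncomputable section

namespace Summit.AnomalousDissipation.AnomalousDissipation.Theorems.DenseLoudDesignerForces.Negative

open scoped BigOperators Topology ENNReal InnerProductSpace
open Filter Set MeasureTheory UnitAddTorus
open Literature.Analysis.FunctionSpaces Literature.Analysis.FluidPDE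
open Summit.AnomalousDissipation.AnomalousDissipation.Theses.BaireTransfer

/-! ## §16 Witness anatomy IV: the FLUX CAPACITY of the low modes — a force-free dissipation ceiling

The flux through wavenumber `N` is the work of the Reynolds stress against the strain of the LOW-PASS field,
`Π_N = -∫⟪u, (u·∇)P_N u⟫`, and `‖D(P_N u)‖_∞ ≤ 2π∑ᵢ∑_{|k|≤N}|kᵢ|‖û_k‖ ≤ 6πN√(#B_N)·√E_N`.  Hence
`|Π_N(t)| ≤ 6πN√(#B_N) √(E_N(t)) ‖u(t)‖₂²` (`abs_flux_le`) and, with the constant-flux law,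
`⟨ν‖∇u‖²⟩ ≤ 6πN√(#B_N) · τ⁻¹∫₀^τ √E_N ‖u‖₂² + 4π²N²ν⟨‖u‖²⟩` for EVERY periodic classical orbit forced in the band
`S ⊆ B_N` (`meanDissipation_le_capacity`) — a dissipation ceiling in which the AMPLITUDE of the force does not appear
(only its band), the periodic-orbit form of the Doering–Foias bound `ε ≲ U³/ℓ`.  On the loud set
(`capacity_floor_of_loud`): `ε - 4π²N²E/(j+1) ≤ 6πN√(#B_N) τ⁻¹∫₀^τ √(E_N)‖u‖₂² ≤ 6πN√(#B_N) τ⁻¹∫₀^τ ‖u‖₂³` —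
a force-free floor on the low-mode amplitude weighted by the energy (and on the cubic moment `⟨‖u‖₂³⟩`): the
throughput `ε` of the cascade is limited by how much large-scale strain the orbit keeps. -/

section Capacity

variable {S : Finset (Fin 3 → ℤ)} {ν τ : ℝ} {c : ↥S → (EuclideanSpace ℂ (Fin 3))} {u : ℝ → (UnitAddTorus (Fin 3)) → (EuclideanSpace ℝ (Fin 3))} {p : ℝ → (UnitAddTorus (Fin 3)) → ℝ}

/-- The GRADIENT BOUND `2π ∑ᵢ ∑_{k∈B} |kᵢ| ‖g k‖ ≥ ‖D(realTrigPoly B g)‖_∞` of a real trigonometric polynomial. -/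
def polyGradBound (B : Finset (Fin 3 → ℤ)) (g : (Fin 3 → ℤ) → (EuclideanSpace ℂ (Fin 3))) : ℝ :=
  ∑ i : Fin 3, ∑ k ∈ B, 2 * Real.pi * |((k i : ℤ) : ℝ)| * ‖g k‖

/-- Partial derivatives of a real trigonometric polynomial are bounded by `∑_{k∈B} 2π|kᵢ|‖g k‖`. -/
theorem norm_partialDeriv_realTrigPoly_le (B : Finset (Fin 3 → ℤ)) (g : (Fin 3 → ℤ) → (EuclideanSpace ℂ (Fin 3))) (i : Fin 3) (x : (UnitAddTorus (Fin 3))) :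
    ‖Torus.partialDeriv i (Torus.realTrigPoly B g) x‖ ≤ ∑ k ∈ B, 2 * Real.pi * |((k i : ℤ) : ℝ)| * ‖g k‖ := by
  rw [Torus.partialDeriv_realTrigPoly, Torus.realTrigPoly_apply]
  refine (norm_realPart_le _).trans ((norm_trigPoly_apply_le B _ x).trans ?_)
  refine Finset.sum_le_sum fun k _ => ?_
  rw [norm_smul]
  have h1 : ‖(2 * Real.pi * Complex.I * ((k i : ℤ) : ℂ))‖ = 2 * Real.pi * |((k i : ℤ) : ℝ)| := by
    rw [norm_mul, norm_mul, norm_mul, Complex.norm_I, mul_one, Complex.norm_intCast, Complex.norm_ofNat,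
      Complex.norm_real, Real.norm_eq_abs, abs_of_pos Real.pi_pos]
  rw [h1]

/-- `‖D(realTrigPoly B g)(x) w‖ ≤ polyGradBound B g · ‖w‖`. -/
theorem norm_fderiv_realTrigPoly_le (B : Finset (Fin 3 → ℤ)) (g : (Fin 3 → ℤ) → (EuclideanSpace ℂ (Fin 3))) (x : (UnitAddTorus (Fin 3))) (w : (EuclideanSpace ℝ (Fin 3))) :
    ‖Torus.fderiv (Torus.realTrigPoly B g) x w‖ ≤ polyGradBound B g * ‖w‖ := by
  rw [Torus.fderiv_apply_eq_sum_partialDeriv ((Torus.isSmooth_realTrigPoly B g).isContDiff (by simp)) x w]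
  refine (norm_sum_le _ _).trans ?_
  unfold polyGradBound
  rw [Finset.sum_mul]
  refine Finset.sum_le_sum fun i _ => ?_
  rw [norm_smul]
  calc ‖w i‖ * ‖Torus.partialDeriv i (Torus.realTrigPoly B g) x‖
      ≤ ‖w‖ * ∑ k ∈ B, 2 * Real.pi * |((k i : ℤ) : ℝ)| * ‖g k‖ :=
        mul_le_mul (PiLp.norm_apply_le w i) (norm_partialDeriv_realTrigPoly_le B g i x) (norm_nonneg _) (norm_nonneg _)
    _ = (∑ k ∈ B, 2 * Real.pi * |((k i : ℤ) : ℝ)| * ‖g k‖) * ‖w‖ := mul_comm _ _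

/-- On the frequency ball every coordinate is at most the radius: `|kᵢ| ≤ N`. -/
theorem abs_apply_le_of_mem_freqBall {N : ℕ} {k : Fin 3 → ℤ} (hk : k ∈ Torus.freqBall N) (i : Fin 3) :
    |((k i : ℤ) : ℝ)| ≤ (N : ℝ) := by
  have h1 : ((k i : ℤ) : ℝ) ^ 2 ≤ Torus.freqNormSq k := by
    unfold Torus.freqNormSq
    exact Finset.single_le_sum (f := fun j => ((k j : ℤ) : ℝ) ^ 2) (fun j _ => sq_nonneg _) (Finset.mem_univ i)
  exact abs_le_of_sq_le_sq (h1.trans (Torus.mem_freqBall.1 hk)) (Nat.cast_nonneg N)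

/-- On the ball of radius `N`: `polyGradBound ≤ 6πN √(#B_N) · (∑‖g k‖²)^{1/2}` (coordinate bound and Cauchy–Schwarz). -/
theorem polyGradBound_freqBall_le (N : ℕ) (g : (Fin 3 → ℤ) → (EuclideanSpace ℂ (Fin 3))) :
    polyGradBound (Torus.freqBall N) g ≤
      6 * Real.pi * (N : ℝ) * Real.sqrt ((Torus.freqBall (d := Fin 3) N).card) * Real.sqrt (∑ k ∈ Torus.freqBall N, ‖g k‖ ^ 2) := by
  set B := Torus.freqBall (d := Fin 3) N with hB
  have hsum : ∀ i : Fin 3, ∑ k ∈ B, 2 * Real.pi * |((k i : ℤ) : ℝ)| * ‖g k‖ ≤ 2 * Real.pi * (N : ℝ) * ∑ k ∈ B, ‖g k‖ := by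
    intro i
    rw [Finset.mul_sum]
    refine Finset.sum_le_sum fun k hk => ?_
    have := abs_apply_le_of_mem_freqBall hk i
    have h0 : 0 ≤ ‖g k‖ := norm_nonneg _
    have hpi : 0 ≤ 2 * Real.pi := by positivity
    calc 2 * Real.pi * |((k i : ℤ) : ℝ)| * ‖g k‖ = 2 * Real.pi * (|((k i : ℤ) : ℝ)| * ‖g k‖) := by ring
      _ ≤ 2 * Real.pi * ((N : ℝ) * ‖g k‖) := by gcongr
      _ = 2 * Real.pi * (N : ℝ) * ‖g k‖ := by ring
  have hCS : ∑ k ∈ B, ‖g k‖ ≤ Real.sqrt (B.card) * Real.sqrt (∑ k ∈ B, ‖g k‖ ^ 2) := by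
    have h := Finset.sum_mul_sq_le_sq_mul_sq B (fun _ => (1 : ℝ)) (fun k => ‖g k‖)
    simp only [one_pow, Finset.sum_const, nsmul_eq_mul, mul_one, one_mul] at h
    have h0 : 0 ≤ ∑ k ∈ B, ‖g k‖ := Finset.sum_nonneg fun _ _ => norm_nonneg _
    rw [← Real.sqrt_mul (Nat.cast_nonneg _), ← Real.sqrt_sq h0]
    exact Real.sqrt_le_sqrt h
  unfold polyGradBound
  calc ∑ i : Fin 3, ∑ k ∈ B, 2 * Real.pi * |((k i : ℤ) : ℝ)| * ‖g k‖
      ≤ ∑ _i : Fin 3, 2 * Real.pi * (N : ℝ) * ∑ k ∈ B, ‖g k‖ := Finset.sum_le_sum fun i _ => hsum i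
    _ = 3 * (2 * Real.pi * (N : ℝ) * ∑ k ∈ B, ‖g k‖) := by simp
    _ ≤ 3 * (2 * Real.pi * (N : ℝ) * (Real.sqrt (B.card) * Real.sqrt (∑ k ∈ B, ‖g k‖ ^ 2))) := by
        gcongr
    _ = 6 * Real.pi * (N : ℝ) * Real.sqrt (B.card) * Real.sqrt (∑ k ∈ B, ‖g k‖ ^ 2) := by ring

/-- FLUX CAPACITY (slice): `|Π_N(t)| ≤ 6πN√(#B_N) √(E_N(t)) ∫‖u(t)‖²` for a smooth divergence-free field. -/
theorem abs_flux_le {v : (UnitAddTorus (Fin 3)) → (EuclideanSpace ℝ (Fin 3))} (hv : Torus.IsSmooth v) (hdiv : Torus.IsDivFree v) (N : ℕ) :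
    |∫ x, ⟪Torus.convect v v x, Torus.fourierTruncate N v x⟫_ℝ| ≤
      6 * Real.pi * (N : ℝ) * Real.sqrt ((Torus.freqBall (d := Fin 3) N).card) *
        Real.sqrt (∑ k ∈ Torus.freqBall N, ‖mFourierCoeff (EuclideanSpace.complexify ∘ v) k‖ ^ 2) *
          ∫ x, ‖v x‖ ^ 2 := by
  set φ := Torus.fourierTruncate N v with hφdef
  have hφ : Torus.IsSmooth φ := Torus.isSmooth_fourierTruncate N v
  set M := polyGradBound (Torus.freqBall N) (fun k => mFourierCoeff (EuclideanSpace.complexify ∘ v) k) with hMdef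
  have hM : ∀ x w, ‖Torus.fderiv φ x w‖ ≤ M * ‖w‖ := fun x w => norm_fderiv_realTrigPoly_le _ _ x w
  rw [Torus.integral_inner_convect_eq_neg hv hdiv hv hφ, abs_neg]
  have hb := norm_integral_le_of_norm_le (hv.norm_sq.integrable.const_mul M)
    (ae_of_all _ fun x => show ‖⟪v x, Torus.convect v φ x⟫_ℝ‖ ≤ M * ‖v x‖ ^ 2 from by
      rw [Real.norm_eq_abs]
      calc |⟪v x, Torus.convect v φ x⟫_ℝ| ≤ ‖v x‖ * ‖Torus.convect v φ x‖ := abs_real_inner_le_norm _ _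
        _ ≤ ‖v x‖ * (M * ‖v x‖) := by
            gcongr
            exact hM x (v x)
        _ = M * ‖v x‖ ^ 2 := by ring)
  rw [Real.norm_eq_abs, integral_const_mul] at hb
  refine hb.trans (mul_le_mul_of_nonneg_right (polyGradBound_freqBall_le N _) (integral_nonneg fun _ => sq_nonneg _))

/-- `t ↦ √(E_N(t)) ∫‖u(t)‖²` is continuous. -/
theorem continuous_capacity (hu : Torus.IsSmoothSpaceTimeOn univ u) (N : ℕ) :
    Continuous fun t => Real.sqrt (lowEnergy N u t) * ∫ x, ‖u t x‖ ^ 2 := by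
  have he_st : Torus.IsSmoothSpaceTimeOn univ (fun t x => ‖u t x‖ ^ 2) := by
    change ContDiffOn ℝ _ (fun z => ‖Torus.stLift u z‖ ^ 2) _
    exact hu.norm_sq ℝ
  have he_cont : Continuous fun t => ∫ x, ‖u t x‖ ^ 2 :=
    continuousOn_univ.1 (he_st.continuousOn_integral convex_univ)
  have hE : Continuous (lowEnergy N u) := by
    unfold lowEnergy
    exact continuous_finsetSum _ fun k _ => (continuous_mFourierCoeff_slice hu k).norm.pow 2
  exact hE.sqrt.mul he_cont

/-- FORCE-FREE DISSIPATION CEILING (periodic-orbit Doering–Foias bound): for every `τ`-periodic classical orbit forced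
in the band `S ⊆ B_N` (`ν ≥ 0`),
`⟨ν‖∇u‖²⟩ ≤ 6πN√(#B_N) · τ⁻¹∫₀^τ √(E_N)‖u‖₂² + 4π²N²ν⟨‖u‖²⟩` — the amplitude of the force does not appear. -/
theorem meanDissipation_le_capacity (hsol : Torus.IsClassicalNSSolutionOn univ ν (fun _ => force S c) u p)
    {N : ℕ} (hS : S ⊆ Torus.freqBall N) (hν : 0 ≤ ν) (hper : Function.Periodic u τ) (hτ : 0 < τ) :
    meanDissipation ν u ≤
      6 * Real.pi * (N : ℝ) * Real.sqrt ((Torus.freqBall (d := Fin 3) N).card) *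
          (τ⁻¹ * ∫ t in (0 : ℝ)..τ, Real.sqrt (lowEnergy N u t) * ∫ x, ‖u t x‖ ^ 2) +
        4 * Real.pi ^ 2 * (N : ℝ) ^ 2 * ν * meanEnergy u := by
  have hu := hsol.smooth_velocity
  have hge := mean_flux_ge hsol hS hν hper hτ
  set K : ℝ := 6 * Real.pi * (N : ℝ) * Real.sqrt ((Torus.freqBall (d := Fin 3) N).card) with hK
  have hK0 : 0 ≤ K := by positivity
  have hpt : ∀ t, flux N u t ≤ K * (Real.sqrt (lowEnergy N u t) * ∫ x, ‖u t x‖ ^ 2) := by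
    intro t
    have h := abs_flux_le (hu.isSmooth_slice (mem_univ t)) (hsol.divFree t (mem_univ t)) N
    have := le_abs_self (flux N u t)
    unfold flux lowEnergy
    unfold flux at this
    linarith [h]
  have hmono : ∫ t in (0 : ℝ)..τ, flux N u t ≤ ∫ t in (0 : ℝ)..τ, K * (Real.sqrt (lowEnergy N u t) * ∫ x, ‖u t x‖ ^ 2) :=
    intervalIntegral.integral_mono_on hτ.le ((continuous_flux hsol hS).intervalIntegrable _ _)
      (((continuous_capacity hu N).const_mul K).intervalIntegrable _ _) fun t _ => hpt t
  rw [intervalIntegral.integral_const_mul] at hmono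
  have hτinv : 0 ≤ τ⁻¹ := inv_nonneg.2 hτ.le
  have h2 : τ⁻¹ * ∫ t in (0 : ℝ)..τ, flux N u t ≤
      K * (τ⁻¹ * ∫ t in (0 : ℝ)..τ, Real.sqrt (lowEnergy N u t) * ∫ x, ‖u t x‖ ^ 2) := by
    calc τ⁻¹ * ∫ t in (0 : ℝ)..τ, flux N u t
        ≤ τ⁻¹ * (K * ∫ t in (0 : ℝ)..τ, Real.sqrt (lowEnergy N u t) * ∫ x, ‖u t x‖ ^ 2) :=
          mul_le_mul_of_nonneg_left hmono hτinv
      _ = K * (τ⁻¹ * ∫ t in (0 : ℝ)..τ, Real.sqrt (lowEnergy N u t) * ∫ x, ‖u t x‖ ^ 2) := by ring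
  linarith

variable {E ε : ℝ}

/-- CAPACITY FLOOR ON THE LOUD SET: a witness of `c ∈ LOUD_j(S,E,ε)` keeps
`ε - 4π²N²E/(j+1) ≤ 6πN√(#B_N) · τ⁻¹∫₀^τ √(E_N(t)) ‖u(t)‖₂² dt` for every `N` with `S ⊆ B_N` — the low-pass
amplitude weighted by the energy (a fortiori the cubic moment `τ⁻¹∫‖u‖₂³`) is bounded below by the dissipation
floor, independently of the force. -/
theorem capacity_floor_of_loud (hsol : Torus.IsClassicalNSSolutionOn univ ν (fun _ => force S c) u p)
    {N : ℕ} (hS : S ⊆ Torus.freqBall N) (hν : 0 < ν) {j : ℕ} (hνj : ν < 1 / ((j : ℝ) + 1))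
    (hper : Function.Periodic u τ) (hτ : 0 < τ) (hEu : meanEnergy u ≤ E) (hεu : ε ≤ meanDissipation ν u) :
    ε - 4 * Real.pi ^ 2 * (N : ℝ) ^ 2 * E / ((j : ℝ) + 1) ≤
      6 * Real.pi * (N : ℝ) * Real.sqrt ((Torus.freqBall (d := Fin 3) N).card) *
        (τ⁻¹ * ∫ t in (0 : ℝ)..τ, Real.sqrt (lowEnergy N u t) * ∫ x, ‖u t x‖ ^ 2) := by
  have h1 := mean_flux_ge_of_loud hsol hS hν hνj hper hτ hEu hεu
  have hu := hsol.smooth_velocity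
  -- as in `meanDissipation_le_capacity`
  set K : ℝ := 6 * Real.pi * (N : ℝ) * Real.sqrt ((Torus.freqBall (d := Fin 3) N).card) with hK
  have hK0 : 0 ≤ K := by positivity
  have hpt : ∀ t, flux N u t ≤ K * (Real.sqrt (lowEnergy N u t) * ∫ x, ‖u t x‖ ^ 2) := by
    intro t
    have h := abs_flux_le (hu.isSmooth_slice (mem_univ t)) (hsol.divFree t (mem_univ t)) N
    have := le_abs_self (flux N u t)
    unfold flux lowEnergy
    unfold flux at this
    linarith [h]
  have hmono : ∫ t in (0 : ℝ)..τ, flux N u t ≤ ∫ t in (0 : ℝ)..τ, K * (Real.sqrt (lowEnergy N u t) * ∫ x, ‖u t x‖ ^ 2) :=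
    intervalIntegral.integral_mono_on hτ.le ((continuous_flux hsol hS).intervalIntegrable _ _)
      (((continuous_capacity hu N).const_mul K).intervalIntegrable _ _) fun t _ => hpt t
  rw [intervalIntegral.integral_const_mul] at hmono
  have hτinv : 0 ≤ τ⁻¹ := inv_nonneg.2 hτ.le
  have h2 : τ⁻¹ * ∫ t in (0 : ℝ)..τ, flux N u t ≤
      K * (τ⁻¹ * ∫ t in (0 : ℝ)..τ, Real.sqrt (lowEnergy N u t) * ∫ x, ‖u t x‖ ^ 2) := by
    calc τ⁻¹ * ∫ t in (0 : ℝ)..τ, flux N u t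
        ≤ τ⁻¹ * (K * ∫ t in (0 : ℝ)..τ, Real.sqrt (lowEnergy N u t) * ∫ x, ‖u t x‖ ^ 2) :=
          mul_le_mul_of_nonneg_left hmono hτinv
      _ = K * (τ⁻¹ * ∫ t in (0 : ℝ)..τ, Real.sqrt (lowEnergy N u t) * ∫ x, ‖u t x‖ ^ 2) := by ring
  linarith

/-- The capacity integrand is dominated by the cubic moment: `√(E_N(t)) ∫‖u(t)‖² ≤ (∫‖u(t)‖²)^{3/2}`. -/
theorem capacity_le_cubic (hu : Torus.IsSmoothSpaceTimeOn univ u) (N : ℕ) (t : ℝ) :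
    Real.sqrt (lowEnergy N u t) * ∫ x, ‖u t x‖ ^ 2 ≤ Real.sqrt (∫ x, ‖u t x‖ ^ 2) * ∫ x, ‖u t x‖ ^ 2 :=
  mul_le_mul_of_nonneg_right (Real.sqrt_le_sqrt (lowEnergy_le hu N t)) (integral_nonneg fun _ => sq_nonneg _)

end Capacity

end Summit.AnomalousDissipation.AnomalousDissipation.Theorems.DenseLoudDesignerForces.Negative

end
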